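import Summits.BirchSwinnertonDyer.BirchSwinnertonDyer.Theorems.ResidualThetaTransportAtTwoResidualSignedLambdaLowerCMAtTwoLambdaAssembly
import HarnessLib

/-!
# ONE-SIDED four-term λ-assembly and decoration bookkeeping for RSL_g (STUB-PLAN rev 5 §11.2 / §11.4 (α), (δ))

Route `ResidualThetaTransportAtTwo` (RTT), crux RSL_g `ResidualSignedLambdaLowerCMAtTwo` (stmt-BirchSwinnertonDyer-22608);
the (R≥)ᵖ crux stmt-BirchSwinnertonDyer-26074 is glue above it. Seat `prover-bsd-wall-rtt-p2` g16 (`--supports`, closes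
nothing). Sequel of `…LambdaAssembly` (p659559 / p660063). THEOREMS ONLY (no definition, no named fact, no instance, no
`sorry`); pure algebra over `Λ = A⟦X⟧`, `A` a complete DVR, `K = Frac A`, λ-currency `dim_K (K ⊗_A ·)`; nothing about
curves; BSD is not proved by any of this; 22608 / 26074 stay OPEN.

## What (adapted from the crux sketch `Cruxes/ResidualThetaCountLowerPureAtTwo/Sketch_sidea_k1_g4.lean` §B/§C,
## stub-ideation k1 g4 — kernel-checked there but not importable)
* §1 **`le_finrank_of_fourTerm_oneSided`** (B1): over a division ring, for `V₁ →f Q →g X →h X₀` the bound `m ≤ dim X`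
  follows from `m ≤ dim Q`, the flank `dim V₁ ≤ dim X₀`, and ONLY `ker g ≤ range f`, `range g ≤ ker h`, `h` onto —
  injectivity of `f` (DAG node N3, `𝐇¹_+ = 0`) and `ker h ≤ range g` are NOT used.
* §2 descent of the three one-sided hypotheses along the flat base change `K ⊗_A ·` (B2):
  `ker_lTensor_le_range_lTensor`, `baseChange_comp_apply_eq_zero`.
* §3 **`le_finrank_baseChange_of_fourTerm_oneSided`** — the kit's `le_finrank_baseChange_of_fourTerm` with the
  exactness hypotheses CUT to the 2½ that RSL_g consumes (the existence half of global duality at the plus quotient,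
  composition zero, `Sel₀ ⊆ Sel⁺`); **`…_of_span_C_mul_charIdeal_le`** with the ONE-SIDED flank
  `(C c)·char(𝐇²) ⊆ (C d)·char(𝐇¹/Z)`; **`…_decorated`** — the decoration- and unit-tolerant form (C1): `d + e ≤ λ(Q)`,
  `λ(𝐇¹/Z) ≤ λ(𝐇²) + e`, `λ(𝐇²) ≤ λ(X₀)` ⇒ `d ≤ λ(X)` (the slack `e` of a decorated zeta element cancels).
* §4 (δ) the DECORATION SHIFT (C2): for `z ∈ H` without `Λ`-torsion and `0 ≠ D ∈ Λ`,
  **`finrank_baseChange_quotient_span_smul_eq_add`**: `λ(H/ΛDz) = λ(H/Λz) + λ(Λ/(D))`; the constants wash out: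
  **`finrank_baseChange_quotient_span_C_eq_zero`** (`λ(Λ/(C c)) = 0`), **`finrank_baseChange_quotient_span_C_mul_eq`**
  (`λ(Λ/(C c · F)) = λ(Λ/(F))`), and **`finrank_baseChange_quotient_span_mul_eq_add`** (`λ(Λ/(D·F)) = λ(Λ/(F)) + λ(Λ/(D))`)
  — so `hm : d + e ≤ λ(Λ/(c·D·Lm))` is read off the decorated reciprocity clause `Col⁺_g(loc₂ z) = c·D·Lm` by additivity alone.

References: [Kobayashi2003] Thm. 7.3 ((7.21)); [Washington1997] §13.2; [GreenbergVatsal2000] §2; [BurungaleTian2026] Thm. 2.6.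
-/

set_option autoImplicit false
-- the Theorems namespace of this sub repeats the summit name by design (D-0017 nested layout)
set_option linter.dupNamespace false

noncomputable section

open scoped TensorProduct Classical

namespace Summit.BirchSwinnertonDyer.BirchSwinnertonDyer.Theorems.CharIdealLambda

open Literature.NumberTheory.EllipticCurves

universe u v v' w

/-! ## §1 One-sided rank–nullity over a division ring (B1) -/

section DivisionRing

-- adapted from Cruxes/ResidualThetaCountLowerPureAtTwo/Sketch_sidea_k1_g4.lean §B (stub-ideation k1 g4), B1

/-- **The four-term λ-inequality needs only 2½ of the 4 exactness conditions** (B1). For linear maps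
`V₁ →f Q →g X →h X₀` of finite-dimensional spaces with `ker g ≤ range f`, `range g ≤ ker h` and `h` onto:
`m ≤ dim Q` and `dim V₁ ≤ dim X₀` give `m ≤ dim X`. (`dim X = dim ker h + dim X₀ ≥ dim range g + dim X₀
= dim Q − dim ker g + dim X₀ ≥ dim Q − dim V₁ + dim X₀ ≥ dim Q`.) Injectivity of `f` and `ker h ≤ range g` are not used.
[cite: Kobayashi2003, Thm. 7.3 ((7.21), p. 13)] -/
theorem le_finrank_of_fourTerm_oneSided {L : Type u} [DivisionRing L] {V₁ Q X X₀ : Type v}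
    [AddCommGroup V₁] [Module L V₁] [AddCommGroup Q] [Module L Q] [AddCommGroup X] [Module L X]
    [AddCommGroup X₀] [Module L X₀] [FiniteDimensional L V₁] [FiniteDimensional L Q]
    [FiniteDimensional L X] [FiniteDimensional L X₀]
    (f : V₁ →ₗ[L] Q) (g : Q →ₗ[L] X) (h : X →ₗ[L] X₀)
    (hQ : LinearMap.ker g ≤ LinearMap.range f) (hX : LinearMap.range g ≤ LinearMap.ker h)
    (hh : Function.Surjective h)
    {m : ℕ} (hm : m ≤ Module.finrank L Q) (hflank : Module.finrank L V₁ ≤ Module.finrank L X₀) :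
    m ≤ Module.finrank L X := by
  have h1 := g.finrank_range_add_finrank_ker
  have h2 := h.finrank_range_add_finrank_ker
  have h3 : Module.finrank L (LinearMap.ker g) ≤ Module.finrank L V₁ :=
    (Submodule.finrank_mono hQ).trans f.finrank_range_le
  have h4 : Module.finrank L (LinearMap.range g) ≤ Module.finrank L (LinearMap.ker h) :=
    Submodule.finrank_mono hX
  have h5 : Module.finrank L (LinearMap.range h) = Module.finrank L X₀ := by
    rw [LinearMap.range_eq_top.mpr hh, finrank_top]
  omega

end DivisionRing

/-! ## §2 Descent of the one-sided hypotheses along a flat base change (B2) -/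

section Descent

variable {A : Type u} [CommRing A] (K : Type w) [CommRing K] [Algebra A K]
variable {V₁ Q X X₀ : Type v} [AddCommGroup V₁] [Module A V₁] [AddCommGroup Q] [Module A Q]
  [AddCommGroup X] [Module A X] [AddCommGroup X₀] [Module A X₀]

-- adapted from Cruxes/ResidualThetaCountLowerPureAtTwo/Sketch_sidea_k1_g4.lean §B (stub-ideation k1 g4), B2

/-- **`ker g ≤ range f` descends along a flat base change** (B2): by flatness `ker (K ⊗ g) = K ⊗ ker g`
(as the range of `K ⊗ (ker g ↪ Q)`), and `K ⊗ ker g → K ⊗ Q` factors through `K ⊗ V₁` elementwise. [folklore] -/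
theorem ker_lTensor_le_range_lTensor [Module.Flat A K] (f : V₁ →ₗ[A] Q) (g : Q →ₗ[A] X)
    (hQ : LinearMap.ker g ≤ LinearMap.range f) :
    LinearMap.ker (g.lTensor K) ≤ LinearMap.range (f.lTensor K) := by
  intro x hx
  have hker : LinearMap.ker (g.lTensor K) = LinearMap.range ((LinearMap.ker g).subtype.lTensor K) :=
    (Module.Flat.lTensor_exact K (LinearMap.exact_subtype_ker_map g)).linearMap_ker_eq
  rw [hker] at hx
  obtain ⟨y, rfl⟩ := hx
  have : LinearMap.range ((LinearMap.ker g).subtype.lTensor K) ≤ LinearMap.range (f.lTensor K) := by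
    rw [LinearMap.range_le_iff_comap, Submodule.eq_top_iff']
    intro t
    simp only [Submodule.mem_comap]
    induction t using TensorProduct.induction_on with
    | zero => simp
    | tmul k v =>
        obtain ⟨w, hw⟩ : (v : Q) ∈ LinearMap.range f := hQ v.2
        exact ⟨k ⊗ₜ w, by simp [hw]⟩
    | add a b ha hb => rw [map_add]; exact Submodule.add_mem _ ha hb
  exact this ⟨y, rfl⟩

/-- **Composition zero descends**: `range g ≤ ker h` gives `range (K ⊗ g) ≤ ker (K ⊗ h)` (functoriality of `K ⊗_A ·`).
[folklore] -/
theorem range_lTensor_le_ker_lTensor (g : Q →ₗ[A] X) (h : X →ₗ[A] X₀)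
    (hX : LinearMap.range g ≤ LinearMap.ker h) :
    LinearMap.range (g.lTensor K) ≤ LinearMap.ker (h.lTensor K) := by
  have hzero : h.comp g = 0 := by
    ext q
    exact LinearMap.mem_ker.mp (hX ⟨q, rfl⟩)
  rintro _ ⟨y, rfl⟩
  rw [LinearMap.mem_ker, ← LinearMap.comp_apply, ← LinearMap.lTensor_comp, hzero, LinearMap.lTensor_zero,
    LinearMap.zero_apply]

end Descent

/-! ## §3 The one-sided four-term assembly in λ-currency -/

section Assembly

variable {A : Type u} [CommRing A] [IsDomain A] [IsDiscreteValuationRing A]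
  [IsAdicComplete (IsLocalRing.maximalIdeal A) A]
variable (K : Type w) [Field K] [Algebra A K] [IsFractionRing A K]
variable {H1Z Q X X0 : Type v}
  [AddCommGroup H1Z] [Module A H1Z]
  [AddCommGroup Q] [Module (PowerSeries A) Q] [Module A Q] [IsScalarTower A (PowerSeries A) Q]
  [Module.Finite (PowerSeries A) Q]
  [AddCommGroup X] [Module (PowerSeries A) X] [Module A X] [IsScalarTower A (PowerSeries A) X]
  [Module.Finite (PowerSeries A) X]
  [AddCommGroup X0] [Module A X0]

/-- **ONE-SIDED four-term assembly** (STUB-PLAN rev 5 §11.2, `le_finrank_baseChange_of_fourTerm'`): for `A`-linear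
`H1Z →f Q →g X →h X0` with `Q`, `X` finitely generated torsion `Λ`-modules, `K ⊗_A H1Z` finite-dimensional, and ONLY
`ker g ≤ range f` (existence half of global duality at the plus quotient), `range g ≤ ker h` (composition zero), `h` onto
(`Sel₀ ⊆ Sel⁺`): `m ≤ λ(Q)` and `λ(H1Z) ≤ λ(X0)` give `m ≤ λ(X)`. Node N3 (`f` injective) is not consumed.
(`H1Z = 𝐇¹/Z`, `Q = Λ_𝒪/(Col⁺_g(loc₂ Z))`, `X = X⁺_∅`, `X0 = X₀`.)
[cite: Kobayashi2003, Thm. 7.3 ((7.21), p. 13)] [cite: Washington1997, §13.2] -/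
theorem le_finrank_baseChange_of_fourTerm_oneSided [Module.Finite K (K ⊗[A] H1Z)]
    (hQ : Module.IsTorsion (PowerSeries A) Q) (hX : Module.IsTorsion (PowerSeries A) X)
    (f : H1Z →ₗ[A] Q) (g : Q →ₗ[A] X) (h : X →ₗ[A] X0) (hker : LinearMap.ker g ≤ LinearMap.range f)
    (hcomp : LinearMap.range g ≤ LinearMap.ker h) (hh : Function.Surjective h) {m : ℕ}
    (hm : m ≤ Module.finrank K (K ⊗[A] Q))
    (hflank : Module.finrank K (K ⊗[A] H1Z) ≤ Module.finrank K (K ⊗[A] X0)) :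
    m ≤ Module.finrank K (K ⊗[A] X) := by
  haveI := finite_baseChange_of_isTorsion K Q hQ
  haveI := finite_baseChange_of_isTorsion K X hX
  haveI : Module.Flat A K := IsLocalization.flat K (nonZeroDivisors A)
  set f' := f.baseChange K with hf'
  set g' := g.baseChange K with hg'
  set h' := h.baseChange K with hh'
  have hh'surj : Function.Surjective h' := by
    rw [hh', LinearMap.baseChange_eq_ltensor]
    exact LinearMap.lTensor_surjective K hh
  haveI : Module.Finite K (K ⊗[A] X0) := Module.Finite.of_surjective h' hh'surj
  have hker' : LinearMap.ker g' ≤ LinearMap.range f' := by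
    intro x hx
    have hx' : x ∈ LinearMap.ker (g.lTensor K) := by
      rw [LinearMap.mem_ker] at hx ⊢
      rwa [hg', LinearMap.baseChange_eq_ltensor] at hx
    obtain ⟨y, hy⟩ := ker_lTensor_le_range_lTensor K f g hker hx'
    refine ⟨y, ?_⟩
    rw [hf', LinearMap.baseChange_eq_ltensor, hy]
  have hcomp' : LinearMap.range g' ≤ LinearMap.ker h' := by
    rintro _ ⟨y, rfl⟩
    have hy : (g.lTensor K) y ∈ LinearMap.ker (h.lTensor K) :=
      range_lTensor_le_ker_lTensor K g h hcomp ⟨y, rfl⟩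
    rw [LinearMap.mem_ker] at hy ⊢
    rw [hh', hg', LinearMap.baseChange_eq_ltensor, LinearMap.baseChange_eq_ltensor]
    exact hy
  exact le_finrank_of_fourTerm_oneSided f' g' h' hker' hcomp' hh'surj hm hflank

/-- **One-sided assembly with the ONE-SIDED flank** `(C c)·char(H2) ⊆ (C d)·char(H1Z)` (the CM / elliptic-unit direction
`char(𝐇¹/Z) ∣ char(𝐇²)` off constants, STUB-PLAN rev 4 §3.1 (ii)) and compact Poitou–Tate `λ(H2) ≤ λ(X0)`:
`m ≤ λ(Q) ⇒ m ≤ λ(X)`, consuming only `ker g ≤ range f`, `range g ≤ ker h`, `h` onto.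
[cite: BurungaleTian2026, Thm. 2.6 (p. 5)] [cite: Kobayashi2003, Thm. 7.3 ((7.21), p. 13)] -/
theorem le_finrank_baseChange_of_fourTerm_oneSided_of_span_C_mul_charIdeal_le {H2 : Type v'} [AddCommGroup H2]
    [Module (PowerSeries A) H2] [Module A H2] [IsScalarTower A (PowerSeries A) H2] [Module.Finite (PowerSeries A) H2]
    [Module (PowerSeries A) H1Z] [IsScalarTower A (PowerSeries A) H1Z] [Module.Finite (PowerSeries A) H1Z]
    (hH2 : Module.IsTorsion (PowerSeries A) H2) (hH1Z : Module.IsTorsion (PowerSeries A) H1Z) {c d : A} (hc : c ≠ 0)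
    (hd : d ≠ 0)
    (hBT : Ideal.span {PowerSeries.C c} * Module.charIdeal (PowerSeries A) H2 ≤
      Ideal.span {PowerSeries.C d} * Module.charIdeal (PowerSeries A) H1Z)
    (hPT : Module.finrank K (K ⊗[A] H2) ≤ Module.finrank K (K ⊗[A] X0))
    (hQ : Module.IsTorsion (PowerSeries A) Q) (hX : Module.IsTorsion (PowerSeries A) X)
    (f : H1Z →ₗ[A] Q) (g : Q →ₗ[A] X) (h : X →ₗ[A] X0) (hker : LinearMap.ker g ≤ LinearMap.range f)
    (hcomp : LinearMap.range g ≤ LinearMap.ker h) (hh : Function.Surjective h) {m : ℕ}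
    (hm : m ≤ Module.finrank K (K ⊗[A] Q)) :
    m ≤ Module.finrank K (K ⊗[A] X) := by
  haveI := finite_baseChange_of_isTorsion K H1Z hH1Z
  exact le_finrank_baseChange_of_fourTerm_oneSided K hQ hX f g h hker hcomp hh hm
    ((finrank_baseChange_le_of_span_C_mul_charIdeal_le K H2 H1Z hH2 hH1Z hc hd hBT).trans hPT)

-- adapted from Cruxes/ResidualThetaCountLowerPureAtTwo/Sketch_sidea_k1_g4.lean §C (stub-ideation k1 g4), C1

/-- **DECORATION-TOLERANT one-sided assembly** (C1, STUB-PLAN rev 5 §11.1–11.2): if the reciprocity clause is stated for a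
DECORATED zeta element — `d + e ≤ λ(Q)` with `Q = Λ/(c·D·Lm)`, `e = λ(Λ/(D))` — and the Burungale–Tian clause for the
SAME element carries the slack, `λ(H1Z) ≤ λ(H2) + e` (`H1Z = 𝐇¹/Λz`), then with compact Poitou–Tate `λ(H2) ≤ λ(X0)` and
the one-sided exactness the conclusion `d ≤ λ(X)` is `D`-free.
[cite: Kobayashi2003, Thm. 7.3 ((7.21), p. 13)] [cite: BurungaleTian2026, Thm. 2.6 (p. 5)] -/
theorem le_finrank_baseChange_of_fourTerm_oneSided_decorated {H2 : Type v'} [AddCommGroup H2] [Module A H2]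
    [Module.Finite K (K ⊗[A] H1Z)]
    (hQ : Module.IsTorsion (PowerSeries A) Q) (hX : Module.IsTorsion (PowerSeries A) X)
    (f : H1Z →ₗ[A] Q) (g : Q →ₗ[A] X) (h : X →ₗ[A] X0) (hker : LinearMap.ker g ≤ LinearMap.range f)
    (hcomp : LinearMap.range g ≤ LinearMap.ker h) (hh : Function.Surjective h) {d e : ℕ}
    (hi : d + e ≤ Module.finrank K (K ⊗[A] Q))
    (hii : Module.finrank K (K ⊗[A] H1Z) ≤ Module.finrank K (K ⊗[A] H2) + e)
    (hPT : Module.finrank K (K ⊗[A] H2) ≤ Module.finrank K (K ⊗[A] X0)) :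
    d ≤ Module.finrank K (K ⊗[A] X) := by
  haveI := finite_baseChange_of_isTorsion K Q hQ
  haveI := finite_baseChange_of_isTorsion K X hX
  haveI : Module.Flat A K := IsLocalization.flat K (nonZeroDivisors A)
  set f' := f.baseChange K with hf'
  set g' := g.baseChange K with hg'
  set h' := h.baseChange K with hh'
  have hh'surj : Function.Surjective h' := by
    rw [hh', LinearMap.baseChange_eq_ltensor]
    exact LinearMap.lTensor_surjective K hh
  haveI : Module.Finite K (K ⊗[A] X0) := Module.Finite.of_surjective h' hh'surj
  have hker' : LinearMap.ker g' ≤ LinearMap.range f' := by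
    intro x hx
    have hx' : x ∈ LinearMap.ker (g.lTensor K) := by
      rw [LinearMap.mem_ker] at hx ⊢
      rwa [hg', LinearMap.baseChange_eq_ltensor] at hx
    obtain ⟨y, hy⟩ := ker_lTensor_le_range_lTensor K f g hker hx'
    refine ⟨y, ?_⟩
    rw [hf', LinearMap.baseChange_eq_ltensor, hy]
  have hcomp' : LinearMap.range g' ≤ LinearMap.ker h' := by
    rintro _ ⟨y, rfl⟩
    have hy : (g.lTensor K) y ∈ LinearMap.ker (h.lTensor K) :=
      range_lTensor_le_ker_lTensor K g h hcomp ⟨y, rfl⟩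
    rw [LinearMap.mem_ker] at hy ⊢
    rw [hh', hg', LinearMap.baseChange_eq_ltensor, LinearMap.baseChange_eq_ltensor]
    exact hy
  -- rank–nullity over `K`
  have h1 := g'.finrank_range_add_finrank_ker
  have h2 := h'.finrank_range_add_finrank_ker
  have h3 : Module.finrank K (LinearMap.ker g') ≤ Module.finrank K (K ⊗[A] H1Z) :=
    (Submodule.finrank_mono hker').trans f'.finrank_range_le
  have h4 : Module.finrank K (LinearMap.range g') ≤ Module.finrank K (LinearMap.ker h') :=
    Submodule.finrank_mono hcomp'
  have h5 : Module.finrank K (LinearMap.range h') = Module.finrank K (K ⊗[A] X0) := by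
    rw [LinearMap.range_eq_top.mpr hh'surj, finrank_top]
  omega

end Assembly

/-! ## §4 (δ) The decoration shift `λ(H/ΛDz) = λ(H/Λz) + λ(Λ/(D))` and the constants (C2) -/

section Decoration

variable {A : Type u} [CommRing A] [IsDomain A] [IsDiscreteValuationRing A]
  [IsAdicComplete (IsLocalRing.maximalIdeal A) A]
variable (K : Type w) [Field K] [Algebra A K] [IsFractionRing A K]

-- adapted from Cruxes/ResidualThetaCountLowerPureAtTwo/Sketch_sidea_k1_g4.lean §C (stub-ideation k1 g4), C2 (signature there)

/-- **The decoration shifts the zeta quotient by exactly `λ(Λ/(D))`** (C2): for a finitely generated `Λ`-module `H`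
(`= 𝐇¹(T_g)`), `z ∈ H` without `Λ`-torsion (`a•z = 0 ⇒ a = 0`; only this much of «torsion free of rank one», Kato 12.4,
is used), `H/Λz` torsion and `0 ≠ D ∈ Λ`: `0 → Λz/ΛDz ≅ Λ/(D) → H/ΛDz → H/Λz → 0` is exact, so
`λ(H/ΛDz) = λ(H/Λz) + λ(Λ/(D))`. [cite: Kato2004Asterisque, Thm. 12.4 (2) (p. 221)] [cite: Washington1997, §13.2] -/
theorem finrank_baseChange_quotient_span_smul_eq_add {H : Type u} [AddCommGroup H] [Module (PowerSeries A) H]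
    [Module A H] [IsScalarTower A (PowerSeries A) H] [Module.Finite (PowerSeries A) H]
    (z : H) (hz : ∀ a : PowerSeries A, a • z = 0 → a = 0) (D : PowerSeries A) (hD : D ≠ 0)
    (htors : Module.IsTorsion (PowerSeries A) (H ⧸ Submodule.span (PowerSeries A) {z})) :
    Module.finrank K (K ⊗[A] (H ⧸ Submodule.span (PowerSeries A) {D • z})) =
      Module.finrank K (K ⊗[A] (H ⧸ Submodule.span (PowerSeries A) {z})) +
        Module.finrank K (K ⊗[A] (PowerSeries A ⧸ Ideal.span {D})) := by
  classical
  set Λz := Submodule.span (PowerSeries A) {z} with hΛz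
  set ΛDz := Submodule.span (PowerSeries A) {D • z} with hΛDz
  have hle : ΛDz ≤ Λz := by
    rw [hΛDz, Submodule.span_singleton_le_iff_mem]
    exact Submodule.smul_mem _ _ (Submodule.mem_span_singleton_self z)
  -- the middle term is a finitely generated torsion `Λ`-module
  have htorsD : Module.IsTorsion (PowerSeries A) (H ⧸ ΛDz) := by
    intro x
    induction x using Submodule.Quotient.induction_on with
    | H y =>
      obtain ⟨⟨a, ha⟩, hay⟩ := @htors (Λz.mkQ y)
      rw [Submonoid.mk_smul, Submodule.mkQ_apply, ← Submodule.Quotient.mk_smul,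
        Submodule.Quotient.mk_eq_zero] at hay
      have hay' : a • y ∈ Λz := hay
      rw [hΛz, Submodule.mem_span_singleton] at hay'
      obtain ⟨b, hb⟩ := hay'
      have ha0 : a ≠ 0 := nonZeroDivisors.ne_zero ha
      refine ⟨⟨D * a, mem_nonZeroDivisors_of_ne_zero (mul_ne_zero hD ha0)⟩, ?_⟩
      rw [Submonoid.mk_smul, ← Submodule.Quotient.mk_smul, Submodule.Quotient.mk_eq_zero,
        mul_smul, ← hb, smul_comm, hΛDz]
      exact Submodule.smul_mem _ _ (Submodule.mem_span_singleton_self _)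
  haveI : Module.Finite K (K ⊗[A] (H ⧸ ΛDz)) := finite_baseChange_of_isTorsion K (H ⧸ ΛDz) htorsD
  -- `i : Λ/(D) → H/ΛDz`, `a ↦ a•z`
  have hker_le : Ideal.span {D} ≤ LinearMap.ker ((ΛDz.mkQ).comp (LinearMap.toSpanSingleton (PowerSeries A) H z)) := by
    rw [Ideal.span_le]
    rintro _ ⟨rfl⟩
    rw [SetLike.mem_coe, LinearMap.mem_ker, LinearMap.comp_apply, LinearMap.toSpanSingleton_apply,
      Submodule.mkQ_apply, Submodule.Quotient.mk_eq_zero, hΛDz]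
    exact Submodule.mem_span_singleton_self _
  let i : (PowerSeries A ⧸ Ideal.span {D}) →ₗ[PowerSeries A] (H ⧸ ΛDz) :=
    Submodule.liftQ (Ideal.span {D}) ((ΛDz.mkQ).comp (LinearMap.toSpanSingleton (PowerSeries A) H z)) hker_le
  let π : (H ⧸ ΛDz) →ₗ[PowerSeries A] (H ⧸ Λz) := Submodule.factor hle
  have hi_apply : ∀ a : PowerSeries A, i (Ideal.Quotient.mk (Ideal.span {D}) a) = Submodule.Quotient.mk (a • z) := by
    intro a; rfl
  have hi : Function.Injective i := by
    rw [← LinearMap.ker_eq_bot, Submodule.eq_bot_iff]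
    intro x hx
    obtain ⟨a, rfl⟩ := Ideal.Quotient.mk_surjective x
    rw [LinearMap.mem_ker, hi_apply, Submodule.Quotient.mk_eq_zero, hΛDz, Submodule.mem_span_singleton] at hx
    obtain ⟨b, hb⟩ := hx
    have hab : (b * D - a) • z = 0 := by rw [sub_smul, mul_smul, hb, sub_self]
    have := hz _ hab
    rw [Ideal.Quotient.eq_zero_iff_mem, Ideal.mem_span_singleton']
    exact ⟨b, by rw [sub_eq_zero] at this; exact this⟩
  have hπ : Function.Surjective π := Submodule.factor_surjective hle
  have hexact : Function.Exact i π := by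
    intro x
    constructor
    · intro hx
      induction x using Submodule.Quotient.induction_on with
      | H y =>
        have hy : y ∈ Λz := by
          rw [← Submodule.Quotient.mk_eq_zero]
          exact hx
        rw [hΛz, Submodule.mem_span_singleton] at hy
        obtain ⟨a, rfl⟩ := hy
        exact ⟨Ideal.Quotient.mk _ a, hi_apply a⟩
    · rintro ⟨a, rfl⟩
      obtain ⟨a, rfl⟩ := Ideal.Quotient.mk_surjective a
      rw [hi_apply]
      change Submodule.factor hle (ΛDz.mkQ (a • z)) = 0
      rw [Submodule.factor_mk, Submodule.mkQ_apply, Submodule.Quotient.mk_eq_zero, hΛz]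
      exact Submodule.smul_mem _ _ (Submodule.mem_span_singleton_self z)
  have := LambdaLowerBoundO.finrank_baseChange_eq_of_exact_three K (i.restrictScalars A) (π.restrictScalars A)
    hi hexact hπ
  rw [this, add_comm]

omit [IsDiscreteValuationRing A] [IsAdicComplete (IsLocalRing.maximalIdeal A) A] in
/-- **Constants are `λ`-invisible**: `λ(Λ/(C c)) = 0` for `c ∈ A ∖ 0` (`K ⊗_A ·` kills the `c`-torsion module `Λ/(C c)`).
[cite: Washington1997, §13.2] -/
theorem finrank_baseChange_quotient_span_C_eq_zero {c : A} (hc : c ≠ 0) :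
    Module.finrank K (K ⊗[A] (PowerSeries A ⧸ Ideal.span {PowerSeries.C c})) = 0 := by
  haveI : Subsingleton (K ⊗[A] (PowerSeries A ⧸ Ideal.span {PowerSeries.C c})) :=
    subsingleton_baseChange_of_pow_smul_eq_zero K hc 1 fun x ↦
      pow_smul_eq_zero_of_C_pow_mem (by rw [pow_one]; exact Ideal.mem_span_singleton_self _) x
  exact Module.finrank_zero_of_subsingleton

/-- **`λ(Λ/(D·F)) = λ(Λ/(F)) + λ(Λ/(D))`** for `D, F ∈ Λ ∖ 0` (C2 with `H = Λ`, `z = F`): normλ-additivity in λ-currency.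
[cite: Washington1997, §13.2 (and §7.1 Thm. 7.3)] -/
theorem finrank_baseChange_quotient_span_mul_eq_add {D F : PowerSeries A} (hD : D ≠ 0) (hF : F ≠ 0) :
    Module.finrank K (K ⊗[A] (PowerSeries A ⧸ Ideal.span {D * F})) =
      Module.finrank K (K ⊗[A] (PowerSeries A ⧸ Ideal.span {F})) +
        Module.finrank K (K ⊗[A] (PowerSeries A ⧸ Ideal.span {D})) := by
  have hz : ∀ a : PowerSeries A, a • F = 0 → a = 0 := fun a ha ↦ by
    rw [smul_eq_mul] at ha
    exact (mul_eq_zero.mp ha).resolve_right hF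
  have htors : Module.IsTorsion (PowerSeries A) (PowerSeries A ⧸ Submodule.span (PowerSeries A) {F}) := by
    intro x
    refine ⟨⟨F, mem_nonZeroDivisors_of_ne_zero hF⟩, ?_⟩
    obtain ⟨y, rfl⟩ := Submodule.Quotient.mk_surjective (Submodule.span (PowerSeries A) {F}) x
    rw [Submonoid.mk_smul, ← Submodule.Quotient.mk_smul, Submodule.Quotient.mk_eq_zero, smul_eq_mul, mul_comm]
    exact Ideal.mem_span_singleton'.mpr ⟨y, rfl⟩
  have h := finrank_baseChange_quotient_span_smul_eq_add K (H := PowerSeries A) F hz D hD htors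
  simp only [smul_eq_mul] at h
  exact h

/-- **`λ(Λ/(C c · F)) = λ(Λ/(F))`** for `c ∈ A ∖ 0`, `F ∈ Λ ∖ 0`: the constant of a reciprocity law (`Col⁺_g(loc₂ z) = c·D·Lm`)
washes out of `λ` (STUB-PLAN rev 5 §3.3 U5). [cite: Washington1997, §13.2] -/
theorem finrank_baseChange_quotient_span_C_mul_eq {c : A} (hc : c ≠ 0) {F : PowerSeries A} (hF : F ≠ 0) :
    Module.finrank K (K ⊗[A] (PowerSeries A ⧸ Ideal.span {PowerSeries.C c * F})) =
      Module.finrank K (K ⊗[A] (PowerSeries A ⧸ Ideal.span {F})) := by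
  have hC : (PowerSeries.C c : PowerSeries A) ≠ 0 := fun h0 ↦ hc (by simpa using congrArg PowerSeries.constantCoeff h0)
  rw [finrank_baseChange_quotient_span_mul_eq_add K hC hF, finrank_baseChange_quotient_span_C_eq_zero K hc, add_zero]

/-- **`hm` read off a decorated reciprocity clause by additivity alone** (STUB-PLAN rev 5 §11.2): if `Col = C c · D · Lm` with
`c ∈ A ∖ 0`, `D, Lm ∈ Λ ∖ 0`, then `λ(Λ/(Col)) = λ(Λ/(Lm)) + λ(Λ/(D))`; hence `d ≤ λ(Λ/(Lm))` and `e := λ(Λ/(D))` give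
`d + e ≤ λ(Λ/(Col))`. [cite: Washington1997, §13.2] -/
theorem add_le_finrank_baseChange_quotient_span_of_eq_C_mul_mul {c : A} (hc : c ≠ 0) {D Lm Col : PowerSeries A}
    (hD : D ≠ 0) (hLm : Lm ≠ 0) (hCol : Col = PowerSeries.C c * D * Lm) {d : ℕ}
    (hd : d ≤ Module.finrank K (K ⊗[A] (PowerSeries A ⧸ Ideal.span {Lm}))) :
    d + Module.finrank K (K ⊗[A] (PowerSeries A ⧸ Ideal.span {D})) ≤
      Module.finrank K (K ⊗[A] (PowerSeries A ⧸ Ideal.span {Col})) := by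
  rw [hCol, mul_assoc, finrank_baseChange_quotient_span_C_mul_eq K hc (mul_ne_zero hD hLm),
    finrank_baseChange_quotient_span_mul_eq_add K hD hLm]
  omega

end Decoration

end Summit.BirchSwinnertonDyer.BirchSwinnertonDyer.Theorems.CharIdealLambda

end
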